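import Summits.QuantumFields.QCD.Theses.WilsonQuarkChessboard
import Summits.QuantumFields.QCD.Theorems.QuarksAsStableActionCriticalLineDiamagnetismStubBackgroundSchwarz
import Summits.QuantumFields.QCD.Theorems.QuarksAsStableActionCriticalLineDiamagnetismStubQuarkChessboardOfSchwarz

/-!
# `WilsonQuarkChessboard.QuarkChessboard` (item stmt-QuantumFields-9306) — closing theorem

The quark chessboard estimate `‖det_AP D_W[U]‖^(L⁴) ≤ ∏_c Re det_AP[R_c U]` (all reflection-tiled determinants real `≥ 0`)
on even tori `L ≥ 4`, `m > -1`, is PROVED in the tree: `…StubQuarkChessboardOfSchwarz.lean` (line `Sketch` of crux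
stmt-QuantumFields-9734; FILS iteration of the background Schwarz inequality with hypercube letters, p112660) applied to the
now-proved `BackgroundSchwarz` (`…StubBackgroundSchwarz.lean`, p122491). This file re-exports the composite under the route's
naming convention. Sources: FrohlichIsraelLiebSimon1978 §2; FrohlichLieb1978 Thm 2.2; MontvayMunster1994 §4.2.3.
-/

namespace Summit.QuantumFields.QCD.Theorems

/-- **Item stmt-QuantumFields-9306 (`WilsonQuarkChessboard.QuarkChessboard`), proved** from `BackgroundSchwarz`
(stmt-10349, proved) by the chessboard iteration `stub_quarkChessboard_of_schwarz`. -/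
theorem wilsonQuarkChessboardQuarkChessboard_proof : Theses.WilsonQuarkChessboard.QuarkChessboard :=
  Cruxes.CriticalLineDiamagnetism.ChessboardCellGain.stub_quarkChessboard_of_schwarz
    Cruxes.CriticalLineDiamagnetism.ChessboardCellGain.stub_backgroundSchwarz

end Summit.QuantumFields.QCD.Theorems
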